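import Literature.NumberTheory.LFunctions.TrilinearKloostermanFractionsDiagExpand
import Literature.NumberTheory.LFunctions.TrilinearKloostermanFractionsDiagB
import Literature.NumberTheory.LFunctions.TrilinearKloostermanFractionsDiagInner
import Literature.NumberTheory.LFunctions.TrilinearKloostermanFractionsDiagBook
import Literature.NumberTheory.Sieve.DivisorBound
import HarnessLib

/-!
# Trilinear forms with Kloosterman fractions: the diagonal terms (Bettin–Chandee §3, (3.5), general `A`)

Topic `NumberTheory/LFunctions`.  S. Bettin, V. Chandee, *Trilinear forms with Kloosterman
fractions*, Adv. Math. 328 (2018), §3 "The diagonal terms", (3.5):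
"`𝒟_b ≪ ‖β‖²‖ν‖² L (A(bLN)^{1/2} + AM/(bN) + M) M^ε`", proved from Weil's bound for the incomplete
Kloosterman sums (3.3) (Appendix Lemma 1), the gcd sum (3.4) and "symmetry and the inequality
`2|ab| ≤ a² + b²`"; by Remark 2 the same holds for the twisted moments with the extra factor
`1 + XA/(MN)`.  This file PROVES exactly the hypothesis `hD` of `BC_CbA_bound_of_diagA_offA`
(`TrilinearKloostermanFractionsFrom51.lean`): the bound (3.5) × `L` for the general-`A`, twisted,
amplified diagonal `∑_m Diag_m(c)` with a fixed squarefull `b`, uniformly in the amplifier length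
`L ≥ 1`, with the factor `((1+|ϑ|+|η|)bMN'A)^ε` in place of `M^ε` and
`W = 1 + (|ϑ|+|η|)A/(bN'M)`:

* **`BC_diagA_bound`** — assembled from `BC_diag_norm_le` (expansion), `BC_diag_term_le_B` (Weil,
  (3.3)), `BC_symmetrize_le`, `BC_diag_inner_le` ((3.4)), the divisor bound, and
  `BC_diag_bookkeeping`.

Together with `BettinChandee2018_trilinearKloostermanFractions_of_diagA_offA`
(`TrilinearKloostermanFractionsReciprocity.lean`) this leaves only the off-diagonal bound (4.25)
(hypothesis `hO`) of the source for the named fact.  No new named facts (D-0026).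

## References

* S. Bettin, V. Chandee, Adv. Math. 328 (2018) 1234–1262 (arXiv:1502.00769), §3 ((3.1)–(3.5)),
  Remark 2, Appendix Lemma 1. [BettinChandee2018]
* A. Weil, *On some exponential sums*, PNAS 34 (1948). [Weil1948]
-/

noncomputable section

open Finset Real

namespace Literature.NumberTheory.LFunctions

set_option maxHeartbeats 6000000 in
/-- **Bettin–Chandee (3.5) for the general-`A`, twisted amplified diagonal** (hypothesis `hD` of
`BC_CbA_bound_of_diagA_offA`): for every `ε > 0` there is `K` such that for squarefull `b ≥ 1`,
`M ≥ bN'`, `N' ≥ b`, `A ≥ 1/2`, `ϑ ≠ 0` coprime to `b`, real `η`, `γ` supported on squarefree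
`n ∈ (N', 2N']` coprime to `bϑ`, `ν` supported on `(A, 2A]`, and every `L ≥ 1`,
`‖∑_m Diag_m(c)‖ ≤ K ‖γ‖²‖ν‖² ((1+|ϑ|+|η|)bMN'A)^ε (1 + (|ϑ|+|η|)A/(bN'M)) · L (A(bLN')^{1/2} + AM/(bN') + M)`.
[cite: BettinChandee2018, §3 (3.5) and Remark 2] -/
theorem BC_diagA_bound :
    ∀ ε : ℝ, 0 < ε → ∃ K : ℝ, 0 < K ∧ ∀ (b : ℕ), 0 < b → (∀ p ∈ b.primeFactors, p ^ 2 ∣ b) →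
      ∀ (M N' A : ℝ), 1 / 2 ≤ M → 1 / 2 ≤ N' → (b : ℝ) ≤ N' → (b : ℝ) * N' ≤ M → 1 / 2 ≤ A →
      ∀ (ϑ : ℤ), ϑ ≠ 0 → b.Coprime ϑ.natAbs → ∀ (η : ℝ) (γ ν : ℕ → ℂ),
        (∀ n : ℕ, γ n ≠ 0 → N' < n ∧ (n : ℝ) ≤ 2 * N') →
        (∀ n : ℕ, γ n ≠ 0 → Squarefree n ∧ n.Coprime b ∧ n.Coprime ϑ.natAbs) →
        (∀ a : ℕ, ν a ≠ 0 → A < a ∧ (a : ℝ) ≤ 2 * A) →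
        ∀ L : ℕ, 1 ≤ L →
        ‖∑ m ∈ (Ioc ⌊M⌋₊ ⌊2 * M⌋₊).filter (fun m => m.Coprime b), ∑ ℓ₁ ∈ ((Ioc L (2 * L)).filter (fun ℓ => ℓ.Prime ∧ ℓ.Coprime b ∧ ℓ.Coprime ϑ.natAbs)), ∑ n₁ ∈ Icc 1 ⌊2 * N'⌋₊,
          ∑ ℓ₂ ∈ ((Ioc L (2 * L)).filter (fun ℓ => ℓ.Prime ∧ ℓ.Coprime b ∧ ℓ.Coprime ϑ.natAbs)), ∑ n₂ ∈ Icc 1 ⌊2 * N'⌋₊,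
            (if ℓ₁ * n₁ = ℓ₂ * n₂ then
            (if (ℓ₂ * n₂).Coprime m ∧ ((ℓ₁ * n₁ : ℕ) : ZMod m) = ((ℓ₂ * n₂ : ℕ) : ZMod m) then
              (γ n₁ * ∑ a ∈ Icc 1 ⌊2 * A⌋₊, ν a * Complex.exp (2 * Real.pi * Complex.I *
                ((ϑ : ℂ) * (a : ℂ) * ((((m : ZMod (b * n₁))⁻¹).val : ℕ) : ℂ) / ((b * n₁ : ℕ) : ℂ) +
                  (η : ℂ) * (a : ℂ) / ((m : ℂ) * ((b * n₁ : ℕ) : ℂ))))) *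
              (starRingEnd ℂ) (γ n₂ * ∑ a ∈ Icc 1 ⌊2 * A⌋₊, ν a * Complex.exp (2 * Real.pi * Complex.I *
                ((ϑ : ℂ) * (a : ℂ) * ((((m : ZMod (b * n₂))⁻¹).val : ℕ) : ℂ) / ((b * n₂ : ℕ) : ℂ) +
                  (η : ℂ) * (a : ℂ) / ((m : ℂ) * ((b * n₂ : ℕ) : ℂ))))) else 0) else 0)‖ ≤
          K * (∑ n ∈ Icc 1 ⌊2 * N'⌋₊, ‖γ n‖ ^ 2) * (∑ a ∈ Icc 1 ⌊2 * A⌋₊, ‖ν a‖ ^ 2) *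
            ((1 + |(ϑ : ℝ)| + |η|) * ((b : ℝ) * M * N' * A)) ^ ε * (1 + (|(ϑ : ℝ)| + |η|) * A / ((b : ℝ) * N' * M)) *
            ((L : ℝ) * (A * ((b : ℝ) * (L : ℝ) * N') ^ (1 / 2 : ℝ) + A * M / ((b : ℝ) * N') + M)) := by
  intro ε hε
  have hδ : 0 < ε / 4 := by positivity
  obtain ⟨C, hC1, hC⟩ := Literature.NumberTheory.Sieve.exists_card_divisors_le_mul_rpow hδ
  have hC0 : 0 < C := by linarith
  refine ⟨13312 * C ^ 3 * (1 + 1 / (ε / 4)) * (2 : ℝ) ^ (ε / 4) * (8 : ℝ) ^ ε, by positivity, ?_⟩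
  intro b hb hsqf M N' A hM hN' hbN' hbNM hA ϑ hϑ hbϑ η γ ν hγN hγcop hνA L hL
  classical
  -- basic positivity
  have hM0 : 0 < M := by linarith
  have hA0 : 0 < A := by linarith
  have hN'0 : 0 < N' := by linarith
  have hbr : (1 : ℝ) ≤ b := by exact_mod_cast hb
  have hb0 : (0 : ℝ) < b := by linarith
  have hLr : (1 : ℝ) ≤ L := by exact_mod_cast hL
  have habs : 0 ≤ |(ϑ : ℝ)| + |η| := by positivity
  -- the size parameter `x` and `y = 8x ≥ 1`
  set x : ℝ := ((1 + |(ϑ : ℝ)| + |η|) * ((b : ℝ) * M * N' * A)) with hx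
  have hx_lb : (b : ℝ) * M * N' * A ≤ x := by
    rw [hx]
    have h1 : (1 : ℝ) ≤ 1 + |(ϑ : ℝ)| + |η| := by linarith
    have h0 : 0 ≤ (b : ℝ) * M * N' * A := by positivity
    nlinarith
  have hx0 : 0 < x := lt_of_lt_of_le (by positivity) hx_lb
  set y : ℝ := 8 * x with hy
  have hy1 : 1 ≤ y := by
    rw [hy]
    have : (1 : ℝ) / 8 ≤ (b : ℝ) * M * N' * A := by
      have h1 : (1 : ℝ) * (1 / 2) * (1 / 2) * (1 / 2) ≤ (b : ℝ) * M * N' * A :=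
        mul_le_mul (mul_le_mul (mul_le_mul hbr hM (by norm_num) (by linarith)) hN' (by norm_num)
          (by positivity)) hA (by norm_num) (by positivity)
      linarith
    linarith
  have h2N' : 2 * N' ≤ y := by
    rw [hy]
    have : N' / 4 ≤ (b : ℝ) * M * N' * A := by
      have h1 : (1 : ℝ) * (1 / 2) * N' * (1 / 2) ≤ (b : ℝ) * M * N' * A :=
        mul_le_mul (mul_le_mul_of_nonneg_right (mul_le_mul hbr hM (by norm_num) (by linarith))
          hN'0.le) hA (by norm_num) (by positivity)
      linarith
    linarith
  have h2M : 2 * M ≤ y := by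
    rw [hy]
    have : M / 4 ≤ (b : ℝ) * M * N' * A := by
      have hbN : (1 : ℝ) / 2 ≤ (b : ℝ) * N' := by nlinarith
      have h1 : M * (1 / 2) * (1 / 2) ≤ M * ((b : ℝ) * N') * A :=
        mul_le_mul (mul_le_mul_of_nonneg_left hbN hM0.le) hA (by norm_num) (by positivity)
      linarith
    linarith
  have h8bN2 : 8 * (b : ℝ) * N' ^ 2 ≤ 2 * y := by
    rw [hy]
    have : (b : ℝ) * N' ^ 2 / 2 ≤ (b : ℝ) * M * N' * A := by
      have h1 : (b : ℝ) * ((b : ℝ) * N') * N' * (1 / 2) ≤ (b : ℝ) * M * N' * A :=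
        mul_le_mul (mul_le_mul_of_nonneg_right (mul_le_mul_of_nonneg_left hbNM hb0.le) hN'0.le)
          hA (by norm_num) (by positivity)
      have h2 : (b : ℝ) * N' ^ 2 / 2 ≤ (b : ℝ) * ((b : ℝ) * N') * N' * (1 / 2) := by
        have : (b : ℝ) * N' ^ 2 ≤ (b : ℝ) * ((b : ℝ) * N' ^ 2) := by
          apply mul_le_mul_of_nonneg_left _ hb0.le
          nlinarith
        nlinarith
      linarith
    linarith
  -- `W`, the twist factor, the logarithm, `√(bLN')`
  set W : ℝ := (1 + (|(ϑ : ℝ)| + |η|) * A / ((b : ℝ) * N' * M)) with hW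
  have hW1 : 1 ≤ W := by
    rw [hW]
    have : 0 ≤ (|(ϑ : ℝ)| + |η|) * A / ((b : ℝ) * N' * M) := by positivity
    linarith
  set Tw : ℝ := (1 + 2 * Real.pi * (|η| * (4 * A / ((b : ℝ) * N'))) / M) with hTw
  have hTw0 : 0 ≤ Tw := by rw [hTw]; positivity
  have hTwW : Tw ≤ 26 * W := by
    rw [hTw, hW]; exact BC_diag_twist_le ϑ η hA0.le hb0 hN'0 hM0
  set Lg : ℝ := 1 + Real.log (8 * (b : ℝ) * N' ^ 2) with hLg
  have h8bN1 : (1 : ℝ) ≤ 8 * (b : ℝ) * N' ^ 2 := by nlinarith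
  have hLg0 : 0 ≤ Lg := by
    rw [hLg]; have := Real.log_nonneg h8bN1; linarith
  have hLgle : Lg ≤ (1 + 1 / (ε / 4)) * (2 : ℝ) ^ (ε / 4) * y ^ (ε / 4) := by
    rw [hLg]; exact BC_diag_log_le hδ hy1 h8bN1 h8bN2
  set SQ : ℝ := Real.sqrt ((b : ℝ) * (L : ℝ) * N') with hSQ
  have hSQ0 : 0 ≤ SQ := Real.sqrt_nonneg _
  -- divisor bounds
  have hτ : ∀ n : ℕ, 0 < n → (n : ℝ) ≤ y → ((Nat.divisors n).card : ℝ) ≤ C * y ^ (ε / 4) := by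
    intro n hn hny
    refine (hC n hn.ne').trans ?_
    exact mul_le_mul_of_nonneg_left (Real.rpow_le_rpow (Nat.cast_nonneg _) hny hδ.le) hC0.le
  -- the uniform bound for the inner sums
  set Bmax : ℝ := (1 + C * y ^ (ε / 4)) * (2 * M + (C * y ^ (ε / 4)) ^ 2 * Tw *
      (32 * (2 * M + 1) * A / ((b : ℝ) * N') + 16 * A * SQ * Lg)) with hBmax
  have hCy0 : 0 ≤ C * y ^ (ε / 4) := by positivity
  have hBmax0 : 0 ≤ Bmax := by rw [hBmax]; positivity
  -- the index set, the weights and the vector of the symmetrization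
  set P : Finset ℕ := ((Ioc L (2 * L)).filter (fun ℓ => ℓ.Prime ∧ ℓ.Coprime b ∧ ℓ.Coprime ϑ.natAbs)) with hP
  set I : Finset (ℕ × (ℕ × ℕ)) := P ×ˢ ((Icc 1 ⌊2 * N'⌋₊) ×ˢ (Icc 1 ⌊2 * A⌋₊)) with hI
  set xf : ℕ × (ℕ × ℕ) → ℝ := fun i => ‖γ i.2.1‖ * ‖ν i.2.2‖ with hxf
  set Bf : ℕ → ℕ → ℕ → ℕ → ℕ → ℝ := fun (l₁ k₁ c₁ l₂ c₂ : ℕ) =>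
          (if (((c₁ * l₁ : ℕ) : ℤ) - ((c₂ * l₂ : ℕ) : ℤ)) = 0 then 2 * M else
            ((Nat.divisors (b * (l₁ * k₁))).card : ℝ) *
              ((2 * M + 1) * (Int.gcd (((c₁ * l₁ : ℕ) : ℤ) - ((c₂ * l₂ : ℕ) : ℤ)) (((b * (l₁ * k₁)) : ℕ) : ℤ) : ℝ) / (((b * (l₁ * k₁)) : ℕ) : ℝ) +
                ((Nat.divisors ((b * (l₁ * k₁)) / Int.gcd (((c₁ * l₁ : ℕ) : ℤ) - ((c₂ * l₂ : ℕ) : ℤ)) (((b * (l₁ * k₁)) : ℕ) : ℤ))).card : ℝ) * Real.sqrt ((((b * (l₁ * k₁)) / Int.gcd (((c₁ * l₁ : ℕ) : ℤ) - ((c₂ * l₂ : ℕ) : ℤ)) (((b * (l₁ * k₁)) : ℕ) : ℤ)) : ℕ) : ℝ) *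
                  (1 + Real.log ((((b * (l₁ * k₁)) / Int.gcd (((c₁ * l₁ : ℕ) : ℤ) - ((c₂ * l₂ : ℕ) : ℤ)) (((b * (l₁ * k₁)) : ℕ) : ℤ)) : ℕ) : ℝ))) *
              (1 + 2 * Real.pi * (|η| * |((((c₁ * l₁ : ℕ) : ℤ) - ((c₂ * l₂ : ℕ) : ℤ)) : ℝ)| / (((b * (l₁ * k₁)) : ℕ) : ℝ)) / M)) with hBf
  set w : ℕ × (ℕ × ℕ) → ℕ × (ℕ × ℕ) → ℝ :=
    fun i j => if i.1 * i.2.1 = j.1 * j.2.1 then Bf i.1 i.2.1 i.2.2 j.1 j.2.2 else 0 with hw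
  -- Step 1–2: expansion, norms, and the per-term bound
  have step12 : ‖∑ m ∈ (Ioc ⌊M⌋₊ ⌊2 * M⌋₊).filter (fun m => m.Coprime b), ∑ ℓ₁ ∈ ((Ioc L (2 * L)).filter (fun ℓ => ℓ.Prime ∧ ℓ.Coprime b ∧ ℓ.Coprime ϑ.natAbs)), ∑ n₁ ∈ Icc 1 ⌊2 * N'⌋₊,
          ∑ ℓ₂ ∈ ((Ioc L (2 * L)).filter (fun ℓ => ℓ.Prime ∧ ℓ.Coprime b ∧ ℓ.Coprime ϑ.natAbs)), ∑ n₂ ∈ Icc 1 ⌊2 * N'⌋₊,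
            (if ℓ₁ * n₁ = ℓ₂ * n₂ then
            (if (ℓ₂ * n₂).Coprime m ∧ ((ℓ₁ * n₁ : ℕ) : ZMod m) = ((ℓ₂ * n₂ : ℕ) : ZMod m) then
              (γ n₁ * ∑ a ∈ Icc 1 ⌊2 * A⌋₊, ν a * Complex.exp (2 * Real.pi * Complex.I *
                ((ϑ : ℂ) * (a : ℂ) * ((((m : ZMod (b * n₁))⁻¹).val : ℕ) : ℂ) / ((b * n₁ : ℕ) : ℂ) +
                  (η : ℂ) * (a : ℂ) / ((m : ℂ) * ((b * n₁ : ℕ) : ℂ))))) *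
              (starRingEnd ℂ) (γ n₂ * ∑ a ∈ Icc 1 ⌊2 * A⌋₊, ν a * Complex.exp (2 * Real.pi * Complex.I *
                ((ϑ : ℂ) * (a : ℂ) * ((((m : ZMod (b * n₂))⁻¹).val : ℕ) : ℂ) / ((b * n₂ : ℕ) : ℂ) +
                  (η : ℂ) * (a : ℂ) / ((m : ℂ) * ((b * n₂ : ℕ) : ℂ))))) else 0) else 0)‖ ≤
      ∑ i ∈ I, ∑ j ∈ I, w i j * (xf i * xf j) := by
    refine (BC_diag_norm_le b M N' A ϑ η γ ν L).trans ?_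
    rw [hI, hP]
    simp only [Finset.sum_product, hw, hxf, hBf]
    refine Finset.sum_le_sum fun ℓ₁ hℓ₁ => Finset.sum_le_sum fun n₁ hn₁ =>
      Finset.sum_le_sum fun a₁ _ => Finset.sum_le_sum fun ℓ₂ _ =>
      Finset.sum_le_sum fun n₂ hn₂ => Finset.sum_le_sum fun a₂ _ => ?_
    have hn₁pos : 0 < n₁ := by have := (Finset.mem_Icc.mp hn₁).1; omega
    have hn₂pos : 0 < n₂ := by have := (Finset.mem_Icc.mp hn₂).1; omega
    by_cases hN : ℓ₁ * n₁ = ℓ₂ * n₂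
    · rw [if_pos hN, if_pos hN]
      exact BC_diag_term_le_B ϑ η γ ν hb hM hbϑ hℓ₁ hn₁pos hn₂pos hN hγcop
    · rw [if_neg hN, if_neg hN]
      simp
  -- Step 3: symmetrization
  have hwsymm : ∀ i ∈ I, ∀ j ∈ I, w i j = w j i := by
    rintro ⟨ℓ₁, n₁, a₁⟩ - ⟨ℓ₂, n₂, a₂⟩ -
    simp only [hw, hBf]
    by_cases hN : ℓ₁ * n₁ = ℓ₂ * n₂
    · rw [if_pos hN, if_pos hN.symm]
      exact BC_diagB_symm b ℓ₁ n₁ a₁ ℓ₂ n₂ a₂ M η hN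
    · rw [if_neg hN, if_neg (Ne.symm hN)]
  have hw0 : ∀ i ∈ I, ∀ j ∈ I, 0 ≤ w i j := by
    rintro ⟨ℓ₁, n₁, a₁⟩ - ⟨ℓ₂, n₂, a₂⟩ -
    simp only [hw, hBf]
    by_cases hN : ℓ₁ * n₁ = ℓ₂ * n₂
    · rw [if_pos hN]
      exact BC_diagB_nonneg b ℓ₁ n₁ a₁ ℓ₂ a₂ η hM0.le
    · rw [if_neg hN]
  have step3 := BC_symmetrize_le I w xf hwsymm hw0
  -- Step 4: the inner sums
  have hinner : ∀ i ∈ I, xf i ≠ 0 → ∑ j ∈ I, w i j ≤ Bmax := by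
    rintro ⟨ℓ₁, n₁, a₁⟩ hi hx0
    rw [hI] at hi
    simp only [Finset.mem_product] at hi
    obtain ⟨hℓ₁, hn₁, ha₁⟩ := hi
    simp only [hxf] at hx0
    have hγ : γ n₁ ≠ 0 := by
      intro h; apply hx0; simp [h]
    obtain ⟨hNn₁, hn₁N⟩ := hγN n₁ hγ
    have hn₁pos : 0 < n₁ := by have := (Finset.mem_Icc.mp hn₁).1; omega
    -- unfold the sum over `j`
    rw [hI]
    simp only [Finset.sum_product, hw]
    -- bound the `n₂`-sum, then restrict to `ℓ₂ ∣ ℓ₁ n₁`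
    have hBf0 : ∀ ℓ₂ a₂ : ℕ, 0 ≤ Bf ℓ₁ n₁ a₁ ℓ₂ a₂ := by
      intro ℓ₂ a₂; simp only [hBf]; exact BC_diagB_nonneg b ℓ₁ n₁ a₁ ℓ₂ a₂ η hM0.le
    have h41 : ∑ ℓ₂ ∈ P, ∑ n₂ ∈ Icc 1 ⌊2 * N'⌋₊, ∑ a₂ ∈ Icc 1 ⌊2 * A⌋₊,
        (if ℓ₁ * n₁ = ℓ₂ * n₂ then Bf ℓ₁ n₁ a₁ ℓ₂ a₂ else 0) ≤
        ∑ ℓ₂ ∈ P, ∑ a₂ ∈ Icc 1 ⌊2 * A⌋₊,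
          (if ℓ₂ ∣ ℓ₁ * n₁ then Bf ℓ₁ n₁ a₁ ℓ₂ a₂ else 0) := by
      refine Finset.sum_le_sum fun ℓ₂ hℓ₂ => ?_
      rw [Finset.sum_comm]
      refine Finset.sum_le_sum fun a₂ _ => ?_
      have hℓ₂pos : 0 < ℓ₂ := by
        rw [hP] at hℓ₂; exact (Finset.mem_filter.mp hℓ₂).2.1.pos
      exact BC_diag_count_le _ hℓ₂pos (hBf0 ℓ₂ a₂)
    have h42 : ∑ ℓ₂ ∈ P, ∑ a₂ ∈ Icc 1 ⌊2 * A⌋₊,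
          (if ℓ₂ ∣ ℓ₁ * n₁ then Bf ℓ₁ n₁ a₁ ℓ₂ a₂ else 0) =
        ∑ ℓ₂ ∈ P.filter (fun ℓ₂ => ℓ₂ ∣ ℓ₁ * n₁), ∑ a₂ ∈ Icc 1 ⌊2 * A⌋₊,
          Bf ℓ₁ n₁ a₁ ℓ₂ a₂ := by
      rw [Finset.sum_filter (s := P) (p := fun ℓ₂ => ℓ₂ ∣ ℓ₁ * n₁)]
      refine Finset.sum_congr rfl fun ℓ₂ _ => ?_
      split_ifs <;> simp
    have h43 : ∑ ℓ₂ ∈ P.filter (fun ℓ₂ => ℓ₂ ∣ ℓ₁ * n₁), ∑ a₂ ∈ Icc 1 ⌊2 * A⌋₊,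
          Bf ℓ₁ n₁ a₁ ℓ₂ a₂ ≤
        (1 + ((Nat.divisors n₁).card : ℝ)) *
          (2 * M + ((Nat.divisors (b * n₁)).card : ℝ) ^ 2 * (1 + 2 * Real.pi * (|η| * (4 * A / ((b : ℝ) * N'))) / M) *
            (32 * (2 * M + 1) * A / ((b : ℝ) * N') +
              16 * A * Real.sqrt ((b : ℝ) * (L : ℝ) * N') * (1 + Real.log (8 * (b : ℝ) * N' ^ 2)))) := by
      rw [hP]
      simp only [hBf]
      exact BC_diag_inner_le ϑ η hb hL hM hA hN'0 (by rw [hP] at hℓ₁; exact hℓ₁) hNn₁ hn₁N ha₁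
    have h44 : (1 + ((Nat.divisors n₁).card : ℝ)) *
          (2 * M + ((Nat.divisors (b * n₁)).card : ℝ) ^ 2 * (1 + 2 * Real.pi * (|η| * (4 * A / ((b : ℝ) * N'))) / M) *
            (32 * (2 * M + 1) * A / ((b : ℝ) * N') +
              16 * A * Real.sqrt ((b : ℝ) * (L : ℝ) * N') * (1 + Real.log (8 * (b : ℝ) * N' ^ 2)))) ≤ Bmax := by
      rw [hBmax, ← hTw, ← hSQ, ← hLg]
      have hn₁y : (n₁ : ℝ) ≤ y := hn₁N.trans h2N'
      have ht₁ := hτ n₁ hn₁pos hn₁y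
      have hbn₁ : 0 < b * n₁ := Nat.mul_pos hb hn₁pos
      have hbn₁y : ((b * n₁ : ℕ) : ℝ) ≤ y := by
        push_cast
        have : (b : ℝ) * n₁ ≤ (b : ℝ) * (2 * N') := mul_le_mul_of_nonneg_left hn₁N hb0.le
        nlinarith
      have ht₂ := hτ (b * n₁) hbn₁ hbn₁y
      have ht₂0 : (0 : ℝ) ≤ ((Nat.divisors (b * n₁)).card : ℝ) := Nat.cast_nonneg _
      have hbr0 : 0 ≤ 32 * (2 * M + 1) * A / ((b : ℝ) * N') + 16 * A * SQ * Lg := by positivity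
      have hsq : ((Nat.divisors (b * n₁)).card : ℝ) ^ 2 ≤ (C * y ^ (ε / 4)) ^ 2 :=
        pow_le_pow_left₀ ht₂0 ht₂ 2
      apply mul_le_mul (by linarith) _ (by positivity) (by positivity)
      apply add_le_add le_rfl
      apply mul_le_mul_of_nonneg_right _ hbr0
      exact mul_le_mul hsq le_rfl hTw0 (by positivity)
    exact (h41.trans (h42.le.trans h43)).trans h44
  have step4 : ∑ i ∈ I, ∑ j ∈ I, w i j * xf i ^ 2 ≤ ∑ i ∈ I, xf i ^ 2 * Bmax := by
    refine Finset.sum_le_sum fun i hi => ?_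
    rw [show ∑ j ∈ I, w i j * xf i ^ 2 = xf i ^ 2 * ∑ j ∈ I, w i j by
      rw [Finset.mul_sum]; exact Finset.sum_congr rfl fun j _ => by ring]
    by_cases hx0 : xf i = 0
    · rw [hx0]; simp
    · exact mul_le_mul_of_nonneg_left (hinner i hi hx0) (sq_nonneg _)
  -- Step 5: `∑_i x_i² = #P ‖γ‖² ‖ν‖² ≤ L ‖γ‖² ‖ν‖²`
  have step5 : ∑ i ∈ I, xf i ^ 2 ≤ (L : ℝ) * (∑ n ∈ Icc 1 ⌊2 * N'⌋₊, ‖γ n‖ ^ 2) * (∑ a ∈ Icc 1 ⌊2 * A⌋₊, ‖ν a‖ ^ 2) := by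
    rw [hI]
    simp only [Finset.sum_product, hxf]
    have hin : ∑ n ∈ Icc 1 ⌊2 * N'⌋₊, ∑ a ∈ Icc 1 ⌊2 * A⌋₊, (‖γ n‖ * ‖ν a‖) ^ 2 =
        (∑ n ∈ Icc 1 ⌊2 * N'⌋₊, ‖γ n‖ ^ 2) * (∑ a ∈ Icc 1 ⌊2 * A⌋₊, ‖ν a‖ ^ 2) := by
      rw [Finset.sum_mul_sum]
      refine Finset.sum_congr rfl fun n _ => Finset.sum_congr rfl fun a _ => by ring
    rw [Finset.sum_const, nsmul_eq_mul, hin]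
    have hcard : P.card ≤ L := by
      rw [hP]
      calc _ ≤ (Ioc L (2 * L)).card := Finset.card_filter_le _ _
        _ = 2 * L - L := Nat.card_Ioc _ _
        _ = L := by omega
    have hcardR : ((P.card : ℕ) : ℝ) ≤ (L : ℝ) := by exact_mod_cast hcard
    have hn0 : 0 ≤ (∑ n ∈ Icc 1 ⌊2 * N'⌋₊, ‖γ n‖ ^ 2) * (∑ a ∈ Icc 1 ⌊2 * A⌋₊, ‖ν a‖ ^ 2) := by positivity
    calc ((P.card : ℕ) : ℝ) * ((∑ n ∈ Icc 1 ⌊2 * N'⌋₊, ‖γ n‖ ^ 2) * (∑ a ∈ Icc 1 ⌊2 * A⌋₊, ‖ν a‖ ^ 2)) ≤ (L : ℝ) * ((∑ n ∈ Icc 1 ⌊2 * N'⌋₊, ‖γ n‖ ^ 2) * (∑ a ∈ Icc 1 ⌊2 * A⌋₊, ‖ν a‖ ^ 2)) :=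
          mul_le_mul_of_nonneg_right hcardR hn0
      _ = _ := by ring
  -- Step 6: bookkeeping
  have hbook : Bmax ≤ 13312 * C ^ 3 * (1 + 1 / (ε / 4)) * (2 : ℝ) ^ (ε / 4) * y ^ (4 * (ε / 4)) * W *
      (A * SQ + A * M / ((b : ℝ) * N') + M) := by
    rw [hBmax]
    exact BC_diag_bookkeeping hM hA0.le hb0 hN'0 hSQ0 hW1 hTw0 hTwW hLg0 hLgle hδ hC1 hy1
      le_rfl hCy0 le_rfl
  have hy4 : y ^ (4 * (ε / 4)) = (8 : ℝ) ^ ε * x ^ ε := by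
    rw [show 4 * (ε / 4) = ε by ring, hy, Real.mul_rpow (by norm_num) hx0.le]
  have hSQ' : SQ = ((b : ℝ) * (L : ℝ) * N') ^ (1 / 2 : ℝ) := by
    rw [hSQ, Real.sqrt_eq_rpow]
  have hnrm0 : 0 ≤ (∑ n ∈ Icc 1 ⌊2 * N'⌋₊, ‖γ n‖ ^ 2) * (∑ a ∈ Icc 1 ⌊2 * A⌋₊, ‖ν a‖ ^ 2) := by positivity
  calc ‖∑ m ∈ (Ioc ⌊M⌋₊ ⌊2 * M⌋₊).filter (fun m => m.Coprime b), ∑ ℓ₁ ∈ ((Ioc L (2 * L)).filter (fun ℓ => ℓ.Prime ∧ ℓ.Coprime b ∧ ℓ.Coprime ϑ.natAbs)), ∑ n₁ ∈ Icc 1 ⌊2 * N'⌋₊,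
          ∑ ℓ₂ ∈ ((Ioc L (2 * L)).filter (fun ℓ => ℓ.Prime ∧ ℓ.Coprime b ∧ ℓ.Coprime ϑ.natAbs)), ∑ n₂ ∈ Icc 1 ⌊2 * N'⌋₊,
            (if ℓ₁ * n₁ = ℓ₂ * n₂ then
            (if (ℓ₂ * n₂).Coprime m ∧ ((ℓ₁ * n₁ : ℕ) : ZMod m) = ((ℓ₂ * n₂ : ℕ) : ZMod m) then
              (γ n₁ * ∑ a ∈ Icc 1 ⌊2 * A⌋₊, ν a * Complex.exp (2 * Real.pi * Complex.I *
                ((ϑ : ℂ) * (a : ℂ) * ((((m : ZMod (b * n₁))⁻¹).val : ℕ) : ℂ) / ((b * n₁ : ℕ) : ℂ) +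
                  (η : ℂ) * (a : ℂ) / ((m : ℂ) * ((b * n₁ : ℕ) : ℂ))))) *
              (starRingEnd ℂ) (γ n₂ * ∑ a ∈ Icc 1 ⌊2 * A⌋₊, ν a * Complex.exp (2 * Real.pi * Complex.I *
                ((ϑ : ℂ) * (a : ℂ) * ((((m : ZMod (b * n₂))⁻¹).val : ℕ) : ℂ) / ((b * n₂ : ℕ) : ℂ) +
                  (η : ℂ) * (a : ℂ) / ((m : ℂ) * ((b * n₂ : ℕ) : ℂ))))) else 0) else 0)‖
      ≤ ∑ i ∈ I, xf i ^ 2 * Bmax := step12.trans (step3.trans step4)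
    _ = (∑ i ∈ I, xf i ^ 2) * Bmax := by rw [Finset.sum_mul]
    _ ≤ ((L : ℝ) * (∑ n ∈ Icc 1 ⌊2 * N'⌋₊, ‖γ n‖ ^ 2) * (∑ a ∈ Icc 1 ⌊2 * A⌋₊, ‖ν a‖ ^ 2)) * (13312 * C ^ 3 * (1 + 1 / (ε / 4)) * (2 : ℝ) ^ (ε / 4) *
          y ^ (4 * (ε / 4)) * W * (A * SQ + A * M / ((b : ℝ) * N') + M)) :=
        mul_le_mul step5 hbook hBmax0 (by positivity)
    _ = _ := by
        rw [hy4, hSQ', hx, hW]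
        ring

end Literature.NumberTheory.LFunctions

end
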